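import Literature.AlgebraicGeometry.HodgeTheory.SpecialisedHypersurfaceFamilyPoints
import HarnessLib

/-!
# Functoriality of the specialised families of hypersurfaces in the specialisation

Family `hodge`, layer `Literature/AlgebraicGeometry/HodgeTheory`; one definition (`baseSpzMap`) and its
proved bookkeeping, no named fact. Companion of `Motives/SpecialisedHypersurfaceFamily` and
`HodgeTheory/SpecialisedHypersurfaceFamilyPoints` (prover seat `hodge-nonav-prover-Ax`, g14, route
`CyclicUnitaryPowers`, crux K1 stmt-HodgeConjecture-19544, programme ZARISKI: sub-families of the
Carlson–Toledo family along PENCILS of branch forms `f₀ + u g`).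

Given a coefficient specialisation `φ : k[a_m | |m| = d] →ₐ[k] k[b_i | i ∈ ι]` (an affine-linear family of
forms of degree `d` on `ℙⁿ⁺¹`, file `SpecialisedHypersurfaceFamily`) and a FURTHER specialisation of the
parameters `λ : k[b_i | i ∈ ι] →ₐ[k] k[c_j | j ∈ ι']` (e.g. a pencil `b_e ↦ (f₀)_e + g_e c`), the composite
`λ ∘ φ` is again a coefficient specialisation, and `Spec λ : 𝔸^{ι'} ⟶ 𝔸^ι` restricts to a morphism of the
bases of nonsingular parameters

* `baseSpzMap φ λ : baseSpz (λ ∘ φ) ⟶ baseSpz φ` (Mathlib `Scheme.Hom.resLE`), over `k`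
  (`baseSpzMap_left_comp_ι`: it is `Spec λ` on the ambient affine spaces);
* on points: `pointHomSpz φ (baseSpzMap t) = pointHomSpz (λ ∘ φ) t ∘ λ` (`pointHomSpz_map_baseSpzMap`,
  `pointAlgHomSpz_map_baseSpzMap`) — the parameter `b` of the image point is `λ` read at the parameter `c`
  of `t`.

## References

* R. Hartshorne, *Algebraic Geometry* (1977), II §3 (base extension; `Spec` of a composite), Ex. 2.18.
  [Hartshorne1977]
* C. Voisin, *Hodge Theory and Complex Algebraic Geometry II* (2003), §6.2.1 (the universal hypersurface and
  its sub-families). [VoisinHodgeII2003]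
-/

noncomputable section

open CategoryTheory AlgebraicGeometry MvPolynomial
open Literature.AlgebraicGeometry.Motives
open Literature.AlgebraicGeometry.Motives.UniversalHypersurface

universe u

namespace Literature.AlgebraicGeometry.HodgeTheory.UniversalHypersurface

variable (k : Type u) [Field k] (n d : ℕ) {ι ι' : Type} (φ : CoeffRing k n d →ₐ[k] MvPolynomial ι k)
  (lam : MvPolynomial ι k →ₐ[k] MvPolynomial ι' k)

/-- `Spec (λ ∘ φ) = Spec λ ≫ Spec φ`. [cite: Hartshorne1977, II Ex. 2.18] -/
theorem specSpz_comp :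
    specSpz k n d (lam.comp φ) = Spec.map (CommRingCat.ofHom lam.toRingHom) ≫ specSpz k n d φ := by
  rw [specSpz, specSpz, ← Spec.map_comp, ← CommRingCat.ofHom_comp]
  rfl

/-- The nonsingular parameters of `λ ∘ φ` are the preimage under `Spec λ` of those of `φ`.
[cite: VoisinHodgeII2003, §6.2.1] -/
theorem baseSpzOpens_comp :
    baseSpzOpens k n d (lam.comp φ) = Spec.map (CommRingCat.ofHom lam.toRingHom) ⁻¹ᵁ baseSpzOpens k n d φ := by
  rw [baseSpzOpens, baseSpzOpens, specSpz_comp, Scheme.Hom.comp_preimage]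

/-- `Spec λ` is compatible with the structure maps to `Spec k` (`λ` is a `k`-algebra map).
[cite: Hartshorne1977, II §3 (schemes over `S`), p. 89] -/
@[reassoc]
theorem specMap_lam_comp_specSpzToSpec :
    Spec.map (CommRingCat.ofHom lam.toRingHom) ≫ specSpzToSpec k (ι := ι) = specSpzToSpec k (ι := ι') := by
  rw [specSpzToSpec, specSpzToSpec, ← Spec.map_comp, ← CommRingCat.ofHom_comp]
  congr 2
  exact RingHom.ext fun r => lam.commutes r

/-- **The morphism of bases `S_{λ∘φ} ⟶ S_φ` induced by a further specialisation `λ` of the parameters**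
(`Spec λ` restricted to the nonsingular parameters, as a morphism of `k`-schemes).
[cite: Hartshorne1977, II §3 (fibres and base extension), p. 89] -/
def baseSpzMap : baseSpz k n d (lam.comp φ) ⟶ baseSpz k n d φ :=
  Over.homMk ((Spec.map (CommRingCat.ofHom lam.toRingHom)).resLE (baseSpzOpens k n d φ)
      (baseSpzOpens k n d (lam.comp φ)) (baseSpzOpens_comp k n d φ lam).le) (by
    change (Spec.map (CommRingCat.ofHom lam.toRingHom)).resLE (baseSpzOpens k n d φ)
        (baseSpzOpens k n d (lam.comp φ)) (baseSpzOpens_comp k n d φ lam).le ≫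
        (baseSpzOpens k n d φ).ι ≫ specSpzToSpec k = (baseSpzOpens k n d (lam.comp φ)).ι ≫ specSpzToSpec k
    rw [Scheme.Hom.resLE_comp_ι_assoc, specMap_lam_comp_specSpzToSpec])

/-- The underlying morphism of `baseSpzMap` (`rfl`). [cite: Hartshorne1977, II §3, p. 89] -/
theorem baseSpzMap_left : (baseSpzMap k n d φ lam).left =
    (Spec.map (CommRingCat.ofHom lam.toRingHom)).resLE (baseSpzOpens k n d φ)
      (baseSpzOpens k n d (lam.comp φ)) (baseSpzOpens_comp k n d φ lam).le := rfl

/-- `S_{λ∘φ} ⟶ S_φ ⊆ 𝔸^ι` is `S_{λ∘φ} ⊆ 𝔸^{ι'} ⟶ 𝔸^ι`. [cite: Hartshorne1977, II §3, p. 89] -/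
@[reassoc]
theorem baseSpzMap_left_comp_ι :
    (baseSpzMap k n d φ lam).left ≫ (baseSpzOpens k n d φ).ι =
      (baseSpzOpens k n d (lam.comp φ)).ι ≫ Spec.map (CommRingCat.ofHom lam.toRingHom) :=
  Scheme.Hom.resLE_comp_ι _ _

variable {K : Type u} [Field K] [Algebra k K]

/-- **The coefficient homomorphism of the image point**: `pointHomSpz φ (baseSpzMap t) = pointHomSpz (λ∘φ) t ∘ λ`.
[cite: VoisinHodgeII2003, §6.2.1] -/
theorem pointHomSpz_map_baseSpzMap (t : AlgPoints (baseSpz k n d (lam.comp φ)) K) :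
    pointHomSpz k n d φ (AlgPoints.map (baseSpzMap k n d φ lam) t) =
      CommRingCat.ofHom lam.toRingHom ≫ pointHomSpz k n d (lam.comp φ) t := by
  apply Spec.map_injective
  rw [Spec.map_comp, Spec_map_pointHomSpz, Spec_map_pointHomSpz]
  calc (AlgPoints.map (baseSpzMap k n d φ lam) t).left ≫ (baseSpzOpens k n d φ).ι
      = (t.left ≫ (baseSpzMap k n d φ lam).left) ≫ (baseSpzOpens k n d φ).ι := rfl
    _ = t.left ≫ ((baseSpzMap k n d φ lam).left ≫ (baseSpzOpens k n d φ).ι) := Category.assoc _ _ _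
    _ = t.left ≫ ((baseSpzOpens k n d (lam.comp φ)).ι ≫ Spec.map (CommRingCat.ofHom lam.toRingHom)) :=
        whisker_eq _ (baseSpzMap_left_comp_ι k n d φ lam)
    _ = (t.left ≫ (baseSpzOpens k n d (lam.comp φ)).ι) ≫ Spec.map (CommRingCat.ofHom lam.toRingHom) :=
        (Category.assoc _ _ _).symm

/-- The same for the `k`-algebra maps: `ψ_{baseSpzMap t}(F) = ψ_t(λ F)`. [cite: VoisinHodgeII2003, §6.2.1] -/
theorem pointAlgHomSpz_map_baseSpzMap (t : AlgPoints (baseSpz k n d (lam.comp φ)) K) (F : MvPolynomial ι k) :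
    pointAlgHomSpz k n d φ (AlgPoints.map (baseSpzMap k n d φ lam) t) F =
      pointAlgHomSpz k n d (lam.comp φ) t (lam F) := by
  rw [pointAlgHomSpz_apply, pointAlgHomSpz_apply, pointHomSpz_map_baseSpzMap, CommRingCat.hom_comp,
    CommRingCat.hom_ofHom, RingHom.comp_apply]
  rfl

end Literature.AlgebraicGeometry.HodgeTheory.UniversalHypersurface

end
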